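import Literature.Computability.Complexity.Hastad3SatAssembly
import Literature.Computability.Complexity.ConstraintGraphGame
import HarnessLib

/-!
# Håstad's 7/8 + ε theorem for regular expanding constraint graphs (Thm 6.5 from the PCP output, formula level)

The input games of `Hastad3SatAssembly.lean` instantiated with the tree's parallel repetition of the
projection game of a regular constraint graph (`ConstraintGraphGame.lean`: `dartGame`, `dartGame_pow_valLe`
— Dinur–Steurer's parallel repetition for expanding projection games — and `dartGame_pow_sat`), which is the
format in which the PCP theorem by gap amplification hands over its instances (a `d`-regular rotation graph
`G : RotGraph n d` with `λ(G) ≤ λ < 1`, dart constraints `C` over `[W]`, and either a satisfying assignment or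
a gap: every assignment violates `≥ ε n d` darts).  PROVED:

* generic facts on parallel repetitions `B^{⊗k}` (`ParallelRepetitionProduct.lean`): unit weights and
  Bob-regularity are inherited (`wt_pow_eq_one`, `wV_pow`), admissible labels are tuples of admissible labels
  (`adm_prod_iff`, `adm_pow_tuple`);
* `dbl C` — the constraints on the doubled alphabet `[2W]` (`(a, b) ↦ C (a/2) (b/2)`), under which every dart
  with an accepting pair has two distinct accepting pairs (Håstad's test needs two admissible labels, see
  `Hastad3SatCNFSound.sum_deg0_le`); satisfiability and the dart gap transfer both ways (`dbl_sat`, `dbl_gap`);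
* `dartHyp` — the hypotheses `HastadHyp` for `(dartGame (dbl C) (2W)).pow T'`;
* **`hastad_dart_isExactWidth`, `hastad_dart_satisfiable`, `hastad_dart_maxSatFraction_le`** — for every
  `k ≥ 8` and every number of repetitions `T'` with `(√(1 - ε_DS))^{T'} ≤ 1/(4k⁴)` (`ε_DS = dsEps ((1-λ)/2) (ε/2)
  > 0`, so all large `T'` qualify): the explicit E3-CNF `hastadCNF ((dartGame (dbl C) (2W)).pow T') k (dartHyp …)`
  is satisfiable if `(G, C)` is, and has value `≤ 7/8 + 2/k` if every assignment violates `≥ ε n d` darts.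

This is Håstad 2001, Thm 6.5, with the PCP theorem factored out as the hypothesis "such constraint-graph
instances are NP-hard" and the polynomial-time machine of the map left to the machine level (as for the tree's
combinatorial PCP theorem, `RoundInstance.lean`).

## References

* J. Håstad, *Some optimal inapproximability results*, J. ACM 48 (2001) 798–859, Thm 6.5 [Hastad2001].
* I. Dinur, D. Steurer, *Analytical approach to parallel repetition*, STOC 2014, §3.3 [DinurSteurer2014].
* S. Arora, B. Barak, *Computational Complexity: A Modern Approach*, CUP 2009, Claim 22.36 (the projection game
  of a constraint graph) [AroraBarakCC2009].
-/

noncomputable section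

namespace Literature.Computability.Complexity

open Finset

namespace ProjGame

variable {E V U β α : Type} {E' V' U' β' α' : Type}

/-! ### Parallel repetition: weights and admissible labels -/

/-- Admissibility in a product game is admissibility in both factors. [cite: DinurSteurer2014, §2.2] -/
theorem adm_prod_iff (G : ProjGame E V U β α) (H : ProjGame E' V' U' β' α') (v : V) (v' : V') (y : β) (y' : β') :
    (G.prod H).Adm (v, v') (y, y') ↔ G.Adm v y ∧ H.Adm v' y' := by
  constructor
  · intro h
    constructor
    · intro e he
      obtain ⟨e', he'⟩ := H.src_surj v'
      have := h (e, e') (Prod.ext he he')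
      change (prodProj (G.proj e) (H.proj e') (y, y')).isSome = true at this
      unfold prodProj at this
      cases hp : G.proj e y with
      | none => rw [hp] at this; simp at this
      | some a => rfl
    · intro e' he'
      obtain ⟨e, he⟩ := G.src_surj v
      have := h (e, e') (Prod.ext he he')
      change (prodProj (G.proj e) (H.proj e') (y, y')).isSome = true at this
      unfold prodProj at this
      cases hp : G.proj e y with
      | none => rw [hp] at this; simp at this
      | some a =>
        rw [hp] at this
        cases hp' : H.proj e' y' with
        | none => rw [hp'] at this; simp at this
        | some a' => rfl
  · rintro ⟨h, h'⟩ ⟨e, e'⟩ hee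
    obtain ⟨he, he'⟩ := Prod.mk.inj hee
    change (prodProj (G.proj e) (H.proj e') (y, y')).isSome = true
    have h1 := h e he
    have h2 := h' e' he'
    unfold prodProj
    cases hp : G.proj e y with
    | none => rw [hp] at h1; simp at h1
    | some a =>
      cases hp' : H.proj e' y' with
      | none => rw [hp'] at h2; simp at h2
      | some a' => rfl

/-- The label of the one-point game is admissible. [folklore] -/
theorem adm_unit : unit.Adm () () := fun _ _ => rfl

/-- The coordinatewise map of a vertex labelling to nested tuples. [folklore] -/
def tupleNProd (f : V → β) : (k : ℕ) → NProd V k → NProd β k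
  | 0, _ => ()
  | k + 1, v => (f v.1, tupleNProd f k v.2)

/-- The constant nested tuple. [folklore] -/
def constNProd {X : Type} (x : X) : (k : ℕ) → NProd X k
  | 0 => ()
  | k + 1 => (x, constNProd x k)

variable (G : ProjGame E V U β α)

/-- Tuples of admissible labels are admissible in the repetition. [cite: DinurSteurer2014, §2.2] -/
theorem adm_pow_tuple {f : V → β} (hf : ∀ v, G.Adm v (f v)) : ∀ (k : ℕ) (v : NProd V k), (G.pow k).Adm v (tupleNProd f k v)
  | 0, _ => adm_unit
  | k + 1, v => (adm_prod_iff G (G.pow k) v.1 v.2 (f v.1) (tupleNProd f k v.2)).2 ⟨hf v.1, adm_pow_tuple hf k v.2⟩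

omit G in
/-- Tuples of pointwise distinct labellings differ (for `k ≥ 1`). [folklore] -/
theorem tupleNProd_ne {f g : V → β} (hne : ∀ v, f v ≠ g v) : ∀ (k : ℕ), 0 < k → ∀ v : NProd V k,
    tupleNProd f k v ≠ tupleNProd g k v
  | 0, hk, _ => absurd hk (lt_irrefl 0)
  | _ + 1, _, v => fun h => hne v.1 (Prod.mk.inj h).1

/-- Unit weights are inherited by the repetition. [cite: DinurSteurer2014, §2.2] -/
theorem wt_pow_eq_one (h : ∀ e, G.wt e = 1) : ∀ (k : ℕ) (e : NProd E k), (G.pow k).wt e = 1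
  | 0, _ => rfl
  | k + 1, e => by
    change G.wt e.1 * (G.pow k).wt e.2 = 1
    rw [h, wt_pow_eq_one h k e.2, one_mul]

/-- Bob-regularity is inherited by the repetition: `wV ≡ ω ⇒ wV_{⊗k} ≡ ω^k`. [cite: DinurSteurer2014, §2.2] -/
theorem wV_pow [Fintype E] [DecidableEq V] {ω : ℝ} (h : ∀ v, G.wV v = ω) :
    ∀ (k : ℕ) (v : NProd V k), (G.pow k).wV v = ω ^ k
  | 0, _ => by
    change ProjGame.unit.wV _ = _
    unfold wV
    simp [ProjGame.unit]
  | k + 1, v => by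
    change (G.prod (G.pow k)).wV (v.1, v.2) = _
    rw [wV_prod, h, wV_pow h k v.2, pow_succ']

end ProjGame

namespace Expander

namespace RotGraph

open ProjGame

variable {n d : ℕ} (G : RotGraph n d) (C : Fin n → Fin d → ℕ → ℕ → Bool) (W : ℕ) (hd : 0 < d)

/-! ### The doubled alphabet -/

/-- The constraints on the doubled alphabet `[2W]`: `(a, b) ↦ C (a/2) (b/2)`. [cite: Hastad2001, §6.1 (two admissible labels are needed for E3 clauses)] -/
def dbl : Fin n → Fin d → ℕ → ℕ → Bool := fun v i a b => C v i (a / 2) (b / 2)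

/-- A satisfying assignment of `C` doubles to one of `dbl C`. [folklore] -/
theorem dbl_sat {σ : Fin n → ℕ} (hσ : ∀ u, σ u < W) (hsat : ∀ v i, C v i (σ v) (σ (G.nbr v i)) = true) :
    (∀ u, 2 * σ u < 2 * W) ∧ ∀ v i, dbl C v i (2 * σ v) (2 * σ (G.nbr v i)) = true :=
  ⟨fun u => by have := hσ u; omega, fun v i => by
    unfold dbl; rw [Nat.mul_div_cancel_left _ two_pos, Nat.mul_div_cancel_left _ two_pos]; exact hsat v i⟩

/-- The dart gap of `C` transfers to `dbl C` (halve the assignment). [folklore] -/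
theorem dbl_gap {ε : ℝ}
    (hε : ∀ σ : Fin n → ℕ, (∀ u, σ u < W) →
      ε * (n * d) ≤ ((univ.filter fun x : Fin n × Fin d => C x.1 x.2 (σ x.1) (σ (G.nbr x.1 x.2)) = false).card : ℝ)) :
    ∀ σ : Fin n → ℕ, (∀ u, σ u < 2 * W) →
      ε * (n * d) ≤ ((univ.filter fun x : Fin n × Fin d => dbl C x.1 x.2 (σ x.1) (σ (G.nbr x.1 x.2)) = false).card : ℝ) := by
  intro σ hσ
  have h := hε (fun u => σ u / 2) (fun u => by have := hσ u; omega)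
  exact h

/-- The dart game on the doubled alphabet, labels `[2W]²` decoded plainly. [cite: AroraBarakCC2009, Claim 22.36] -/
abbrev dartGame2 := G.dartGame (dbl C) (2 * W) (fun (_ : Fin n × Fin d) (p : Fin (2 * W) × Fin (2 * W)) => p) hd

/-- Admissibility in the plainly decoded dart game is acceptance of the pair. [cite: AroraBarakCC2009, Claim 22.36] -/
theorem adm_dartGame2_iff (δ : Fin n × Fin d) (y : Fin (2 * W) × Fin (2 * W)) :
    (G.dartGame2 C W hd).Adm δ y ↔ dbl C δ.1 δ.2 y.1 y.2 = true := by
  constructor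
  · intro h
    have := h (δ, 0) rfl
    simp only [dartGame_proj, dartProj] at this
    by_contra hC
    rw [Bool.not_eq_true] at hC
    simp [hC] at this
  · intro hC e he
    simp only [dartGame_src] at he
    subst he
    simp [dartGame_proj, dartProj, hC]

section Labels

variable (acc : Fin n → Fin d → ℕ × ℕ)
  (hacc : ∀ v i, (acc v i).1 < W ∧ (acc v i).2 < W ∧ C v i (acc v i).1 (acc v i).2 = true)

omit G in
/-- The first accepting pair `(2a, 2b)` of a dart on the doubled alphabet. [folklore] -/
def lab0Fun (δ : Fin n × Fin d) : Fin (2 * W) × Fin (2 * W) :=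
  (⟨2 * (acc δ.1 δ.2).1, by have := (hacc δ.1 δ.2).1; omega⟩,
    ⟨2 * (acc δ.1 δ.2).2, by have := (hacc δ.1 δ.2).2.1; omega⟩)

omit G in
/-- The second accepting pair `(2a + 1, 2b)` of a dart on the doubled alphabet. [folklore] -/
def lab1Fun (δ : Fin n × Fin d) : Fin (2 * W) × Fin (2 * W) :=
  (⟨2 * (acc δ.1 δ.2).1 + 1, by have := (hacc δ.1 δ.2).1; omega⟩,
    ⟨2 * (acc δ.1 δ.2).2, by have := (hacc δ.1 δ.2).2.1; omega⟩)

omit G in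
/-- The two pairs differ. [folklore] -/
theorem lab0Fun_ne_lab1Fun (δ : Fin n × Fin d) : lab0Fun C W acc hacc δ ≠ lab1Fun C W acc hacc δ := by
  intro h
  have := congrArg (fun p : Fin (2 * W) × Fin (2 * W) => p.1.val) h
  simp [lab0Fun, lab1Fun] at this

/-- The first pair is admissible. [folklore] -/
theorem adm_lab0Fun (δ : Fin n × Fin d) : (G.dartGame2 C W hd).Adm δ (lab0Fun C W acc hacc δ) := by
  rw [adm_dartGame2_iff]
  simp only [lab0Fun, dbl]
  rw [Nat.mul_div_cancel_left _ two_pos, Nat.mul_div_cancel_left _ two_pos]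
  exact (hacc δ.1 δ.2).2.2

/-- The second pair is admissible. [folklore] -/
theorem adm_lab1Fun (δ : Fin n × Fin d) : (G.dartGame2 C W hd).Adm δ (lab1Fun C W acc hacc δ) := by
  rw [adm_dartGame2_iff]
  simp only [lab1Fun, dbl]
  rw [show (2 * (acc δ.1 δ.2).1 + 1) / 2 = (acc δ.1 δ.2).1 by omega, Nat.mul_div_cancel_left _ two_pos]
  exact (hacc δ.1 δ.2).2.2

end Labels

/-- **The hypotheses of the assembly for the repeated dart game**, given an accepting pair of every dart
(`acc`), `n, T' ≥ 1`: unit weights, Bob weight `2^{T'}`, the two admissible labels `(2a, 2b)` and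
`(2a+1, 2b)` coordinatewise. [cite: Hastad2001, §6.1] -/
def dartHyp (acc : Fin n → Fin d → ℕ × ℕ) (hacc : ∀ v i, (acc v i).1 < W ∧ (acc v i).2 < W ∧ C v i (acc v i).1 (acc v i).2 = true)
    (hn : 0 < n) (T' : ℕ) (hT' : 0 < T') : HastadHyp ((G.dartGame2 C W hd).pow T') where
  unit := (G.dartGame2 C W hd).wt_pow_eq_one (fun _ => rfl) T'
  ω := 2 ^ T'
  reg := (G.dartGame2 C W hd).wV_pow (fun δ => G.wV_dartGame (dbl C) (2 * W) _ hd δ) T'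
  lab0 := tupleNProd (lab0Fun C W acc hacc) T'
  lab1 := tupleNProd (lab1Fun C W acc hacc) T'
  adm0 := (G.dartGame2 C W hd).adm_pow_tuple (G.adm_lab0Fun C W hd acc hacc) T'
  adm1 := (G.dartGame2 C W hd).adm_pow_tuple (G.adm_lab1Fun C W hd acc hacc) T'
  ne01 := tupleNProd_ne (lab0Fun_ne_lab1Fun C W acc hacc) T' hT'
  a₀ := constNProd ⟨0, by have := (hacc ⟨0, hn⟩ ⟨0, hd⟩).1; omega⟩ T'
  v₀ := constNProd (⟨0, hn⟩, ⟨0, hd⟩) T'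

/-! ### Håstad's theorem for regular expanding constraint graphs -/

variable (acc : Fin n → Fin d → ℕ × ℕ)
  (hacc : ∀ v i, (acc v i).1 < W ∧ (acc v i).2 < W ∧ C v i (acc v i).1 (acc v i).2 = true)
  (hn : 0 < n) (T' : ℕ) (hT' : 0 < T') (k : ℕ)

/-- **Exact width three.** [cite: Hastad2001, Thm 6.5] -/
theorem hastad_dart_isExactWidth (hk : 0 < k) :
    (((G.dartGame2 C W hd).pow T').hastadCNF k (G.dartHyp C W hd acc hacc hn T' hT') hk).IsExactWidth 3 :=
  ProjGame.isExactWidth_hastadCNF _ k _ hk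

/-- **Completeness**: a satisfying assignment of `(G, C)` with values `< W` makes the CNF satisfiable.
[cite: Hastad2001, Thm 6.5 (satisfiable E3-CNF formulas)] -/
theorem hastad_dart_satisfiable (hk : 0 < k) {σ : Fin n → ℕ} (hσ : ∀ u, σ u < W)
    (hsat : ∀ v i, C v i (σ v) (σ (G.nbr v i)) = true) :
    (((G.dartGame2 C W hd).pow T').hastadCNF k (G.dartHyp C W hd acc hacc hn T' hT') hk).Satisfiable := by
  obtain ⟨hσ2, hsat2⟩ := G.dbl_sat C W hσ hsat
  obtain ⟨b, a, hba⟩ := G.dartGame_pow_sat (dbl C) (2 * W) (fun (_ : Fin n × Fin d) (p : Fin (2 * W) × Fin (2 * W)) => p) hd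
    (fun δ p _ => ⟨p, rfl⟩) hσ2 hsat2 T'
  exact ProjGame.satisfiable_hastadCNF _ k _ hk hba

/-- **Soundness** (Håstad 2001, Thm 6.5, from the PCP output): if `λ(G) ≤ λ < 1`, every assignment with values
`< W` violates at least `ε · n d` darts (`0 < ε ≤ 2`), `k ≥ 8`, and the number of repetitions `T'` satisfies
`(√(1 - ε_DS))^{T'} ≤ 1/(4k⁴)`, then every assignment satisfies at most a fraction `7/8 + 2/k` of the clauses.
[cite: Hastad2001, Thm 6.5] -/
theorem hastad_dart_maxSatFraction_le (hk : 8 ≤ k) {lam ε : ℝ} (hlam : SpectralBound G.walkMatrix lam)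
    (hlam1 : lam < 1) (hε2 : ε ≤ 2)
    (hε : ∀ σ : Fin n → ℕ, (∀ u, σ u < W) →
      ε * (n * d) ≤ ((univ.filter fun x : Fin n × Fin d => C x.1 x.2 (σ x.1) (σ (G.nbr x.1 x.2)) = false).card : ℝ))
    (hT'k : Real.sqrt (1 - ProjGame.dsEps ((1 - lam) / 2) (ε / 2)) ^ T' ≤ 1 / (4 * (k : ℝ) ^ 4)) :
    ((((G.dartGame2 C W hd).pow T').hastadCNF k (G.dartHyp C W hd acc hacc hn T' hT') (by omega)).maxSatFraction : ℝ) ≤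
      7 / 8 + 2 / k := by
  haveI := nonempty_dartEdge hn hd
  have hval := G.dartGame_pow_valLe (dbl C) (2 * W) (fun (_ : Fin n × Fin d) (p : Fin (2 * W) × Fin (2 * W)) => p) hd hn
    hlam hlam1 hε2 (G.dbl_gap C W hε) T'
  exact ProjGame.maxSatFraction_hastadCNF_le _ k _ hk (hval.mono hT'k)

omit G C W hd acc hacc hn T' hT' in
/-- Enough repetitions exist: since `√(1 - ε_DS) < 1` (`ε > 0`), some `T' ≥ 1` has
`(√(1 - ε_DS))^{T'} ≤ 1/(4k⁴)`. [cite: DinurSteurer2014, §3.3 (k = O(log 1/δ) repetitions)] -/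
theorem exists_repetitions (hk : 0 < k) {lam ε : ℝ} (hlam1 : lam < 1) (hε0 : 0 < ε) :
    ∃ T' : ℕ, 0 < T' ∧ Real.sqrt (1 - ProjGame.dsEps ((1 - lam) / 2) (ε / 2)) ^ T' ≤ 1 / (4 * (k : ℝ) ^ 4) := by
  have hlt := sqrt_one_sub_dsEps_lt_one hlam1 hε0
  have hpos : (0 : ℝ) < 1 / (4 * (k : ℝ) ^ 4) := by positivity
  obtain ⟨T', hT'⟩ := exists_pow_lt_of_lt_one hpos hlt
  refine ⟨T' + 1, Nat.succ_pos _, ?_⟩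
  calc Real.sqrt (1 - ProjGame.dsEps ((1 - lam) / 2) (ε / 2)) ^ (T' + 1)
      ≤ Real.sqrt (1 - ProjGame.dsEps ((1 - lam) / 2) (ε / 2)) ^ T' :=
        pow_le_pow_of_le_one (Real.sqrt_nonneg _) hlt.le (Nat.le_succ _)
    _ ≤ 1 / (4 * (k : ℝ) ^ 4) := hT'.le

omit G C W hd acc hacc hn T' hT' k in
/-- The precision for a target `δ > 0`: `k = max 8 ⌈2/δ⌉`, so that `k ≥ 8` and `2/k ≤ δ`. [folklore] -/
theorem exists_precision {δ : ℚ} (hδ : 0 < δ) : ∃ k : ℕ, 8 ≤ k ∧ (2 : ℚ) / k ≤ δ := by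
  refine ⟨max 8 ⌈2 / δ⌉₊, le_max_left _ _, ?_⟩
  have h1 : (2 : ℚ) / δ ≤ ⌈2 / δ⌉₊ := Nat.le_ceil _
  have h2 : (⌈2 / δ⌉₊ : ℚ) ≤ ((max 8 ⌈2 / δ⌉₊ : ℕ) : ℚ) := by exact_mod_cast le_max_right _ _
  have hpos : (0 : ℚ) < ((max 8 ⌈2 / δ⌉₊ : ℕ) : ℚ) := by
    have : (8 : ℕ) ≤ max 8 ⌈2 / δ⌉₊ := le_max_left _ _
    exact_mod_cast Nat.lt_of_lt_of_le (by norm_num) this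
  rw [div_le_iff₀ hpos]
  have h3 : (2 : ℚ) / δ * δ = 2 := div_mul_cancel₀ _ hδ.ne'
  nlinarith

/-- **Håstad 2001, Thm 6.5, `δ`-form at formula level**: for every rational `δ > 0` there are a precision
`k ≥ 8` with `2/k ≤ δ` and a number of repetitions `T' ≥ 1` such that the explicit E3-CNF of the repeated
dart game has value `≤ 7/8 + δ` on instances with dart gap `ε` (and is satisfiable on satisfiable instances,
`hastad_dart_satisfiable`). [cite: Hastad2001, Thm 6.5] -/
theorem hastad_dart_maxSatFraction_le_delta {δ : ℚ} (hδ : 0 < δ) {lam ε : ℝ}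
    (hlam : SpectralBound G.walkMatrix lam) (hlam1 : lam < 1) (hε0 : 0 < ε) (hε2 : ε ≤ 2)
    (hε : ∀ σ : Fin n → ℕ, (∀ u, σ u < W) →
      ε * (n * d) ≤ ((univ.filter fun x : Fin n × Fin d => C x.1 x.2 (σ x.1) (σ (G.nbr x.1 x.2)) = false).card : ℝ)) :
    ∃ (k : ℕ) (hk : 8 ≤ k) (T' : ℕ) (hT' : 0 < T'),
      (((G.dartGame2 C W hd).pow T').hastadCNF k (G.dartHyp C W hd acc hacc hn T' hT') (by omega)).maxSatFraction ≤
        7 / 8 + δ := by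
  obtain ⟨k, hk, hkδ⟩ := exists_precision hδ
  obtain ⟨T', hT', hT'k⟩ := exists_repetitions k (by omega) hlam1 hε0
  refine ⟨k, hk, T', hT', ?_⟩
  have h := G.hastad_dart_maxSatFraction_le C W hd acc hacc hn T' hT' k hk hlam hlam1 hε2 hε hT'k
  have hq : ((7 / 8 + 2 / k : ℚ) : ℝ) = 7 / 8 + 2 / k := by push_cast; ring
  rw [← hq] at h
  have h' : (((G.dartGame2 C W hd).pow T').hastadCNF k (G.dartHyp C W hd acc hacc hn T' hT') (by omega)).maxSatFraction ≤
      7 / 8 + 2 / k := by exact_mod_cast h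
  exact h'.trans (by linarith)

end RotGraph

end Expander

end Literature.Computability.Complexity

end
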